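import Literature.MathematicalPhysics.QuantumFieldTheory.Balaban1983to89.B1Eq324CumulantTaylor
import Literature.MathematicalPhysics.QuantumFieldTheory.Balaban1983to89.B10Eq59Localization
import Literature.MathematicalPhysics.QuantumFieldTheory.Balaban1983to89.TreeLengthTorus

/-!
# `Balaban3D.Proofs.Cumulant59` — [B10] p. 270, the three localisation sentences before **(59)** (k = 0: p. 262,
# (23)–(25)) for the U-DEPENDENT perturbative sum, from the decay (25) over LQB's cube carriers; then the step leaves
# `Cumulant58` / `CumulantLower` from [B1] (3.24) + (25) + the graph representation, and their instances on LQB's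
# concrete 3-torus block system (`TreeLengthTorus.tcubeSys 3 N`)

Lane «pub-balaban3d» (HOME `run/shared/lean/pub/pub-balaban3d/`), seat p5; sequel of `Cumulant324.lean` (the (3.24) cut:
`cumulant58_of_eq324` there takes the localisation as a hypothesis `hloc`; here `hloc` is DERIVED).  Kernel bookkeeping
only; no definition, no named fact; carrier-parametric over `T : B10.TowerRun`, `P : StepPieces T k` (R-PIECES (e)).

THE PRINTED TEXT (renders `…/1985-cmp102-uv-stability-3d-p008-x2.png`, `…-p016-x2.png` read as images).
* p. 262 = PDF 8 L11–32: «We localize vertices in big blocks by a decomposition of unity, and we expand the propagators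
  C⁽⁰⁾(Ω₁, U₁) into the generalized random walk expansion described in [5], Theorem 3.15, Theorem 3.10 … A term in the
  expression, corresponding to the walk ω, satisfies the bound (3.108) [5], i.e. can be bounded by (23) … if X is not
  contained in a cube of the size RM₁, then the exponential factor in (23) yields the factor exp(−R), which is smaller
  than arbitrary power of ε. We estimate all such expressions using this bound and we get O(εᵏ)|T₁|. Summing the
  expressions with the same localization X we get finally the inequality (24)»; L39–40: «|𝒫′₁(g₀, X, U₁)| ≦
  O(g₀)e^{−κ𝓛(X)}, (25) where κ can be arbitrarily large if M₁ is sufficiently large.»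
* p. 270 = PDF 16 L28–37: «We get a sum of terms, each having a localization domain X. Terms with localization domains X
  having non-empty intersections with Ω^c_{k+1} are estimated by O(g_k)|Z_k|. Terms with domains X, which are not
  contained in a cube of the size R(g_k)M₁, are estimated by O((Lᵏε)^{3+κ₀})|T₁^{(k)}|. The remaining terms give the sum
  (59) Σ_X 𝒫′_{k+1}(g_k, X, U_{k+1}) over localizations X ⊂ Ω_{k+1}, which are connected unions of big blocks, and which
  are contained in cubes of the size R(g_k)M₁. The terms 𝒫′_{k+1} satisfy the bound (25) (with the indices 1, 0 replaced
  by k + 1, k)».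
* [B1] p. 616 (3.24): «⟨χ exp(V)⟩ = exp[⟨V⟩ + (1/2!)⟨V²⟩ᵀ + … + (1/n̄!)⟨V^{n̄}⟩ᵀ + O(εᵏ)|T₁|], κ > d.» (`B1Sect3Statements.Eq324`).

DICTIONARY (nothing constructed).  One LQB cube system per step (`S : LocDomainSys`, `G : B12TreeDecay.CubeSystem S`:
the big blocks of T₁^{(k)}, wall adjacency, tree length `S.dj` = 𝓛); activities `a h X U` = the terms of the expansion
with localization domain X («We get a sum of terms, each having a localization domain X»); `hrep` = the graph
representation: the printed cumulant sum `Σ_{n≤n̄} cum n/n!` of (3.24) IS `Σ_X a h X U`; `h25` = (25) for all of them;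
`Ωb h` = the blocks of Ω_{k+1}(h); `hPprU` = (59) AS THE DEFINITION of `P.PprU` (retained: X ⊆ Ω_{k+1}, 𝓛(X) < R — the
threshold reading of «contained in cubes of the size R(g_k)M₁», LQB DIVERGENCE F5); `hZ` = the blocks of Z_k = Ω_{k+1}ᶜ
counted by |Z_k|; `hlarge` = «the factor exp(−R), which is smaller than arbitrary power of ε» booked into the remainder
unit (`(C·g_k·K₀·#blocks)·e^{−R} ≤ C₁·rem`; the arithmetic `e^{−R₁r(g)} ↦ O(rem)` is LQB `B10Assembly.largeLoc_le_rpow`).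

WHAT IS PROVED.
* `loc59_abs_of_bound25` — `|Σ_{n≤n̄} cum n/n! − PprU| ≤ (C·K₀(c₀,Δ))·g_k·|Z_k| + C₁·rem` (LQB
  `B10Eq59Localization.vacuumWholeRaw_shape_exp_neg_R` BY NAME — stated there for the vacuum terms, the inequality is the
  same for U-dependent activities); `loc59_upper_of_bound25`, `loc59_lower_of_bound25` (the trivial history: |Z_k| = 0).
* `cumulant58_of_eq324_bound25` — (58)-reading (`logFl ≤ log lhs + C₀·rem`) + (3.24) per history (`Eq324`, error
  `C₂·s^κ·vol`, `s^κ·vol ≤ rem`) + the above ⇒ `Cumulant58 P (C·K₀(c₀,Δ)) (C₀ + C₁ + C₂)`; `cumulantLower_of_eq324_bound25`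
  ⇒ `CumulantLower P (C₀ + C₁ + C₂)` (no small-field-volume leaf: inside the printed two-sided (3.24)).
* `cumulant58_torus`, `cumulantLower_torus` — the same ON LQB's CONCRETE 3-TORUS block system `tcubeSys 3 N` ((ℤ/N)³ blocks,
  d_j = `torusTreeLen`): wall-degree ≤ 6, volume leaf c₀ = 32 and #blocks = N³ are LQB THEOREMS (`tdegreeLE`, `tvolumeLeaf`,
  `card_tcube`), so only the 𝔇-data hypotheses remain; `Cz = C·K₀(32, 6)`.
[cite: Balaban1985UV3, (23)–(25) p.262 + (58)–(59) p.270]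
-/

open scoped BigOperators Nat

namespace Summit.QuantumFields.Balaban3D.Proofs

open Literature.MathematicalPhysics.QuantumFieldTheory.Balaban1983to89
open Literature.MathematicalPhysics.QuantumFieldTheory.Balaban1983to89.B10 (TowerRun)
open Literature.MathematicalPhysics.QuantumFieldTheory.Balaban1983to89.B10SectAGathering
  (StepPieces Cumulant58 CumulantLower)
open Literature.MathematicalPhysics.QuantumFieldTheory.Balaban1983to89.B1Sect3Statements (Eq324)

/-! ## §1 The localisation sentences before (59) from the graph representation and the decay (25) -/

section Loc59

open Literature.MathematicalPhysics.QuantumFieldTheory.Balaban1983to89.B12TreeDecay (CubeSystem kappa₀ K₀ K₀_pos)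
open Literature.MathematicalPhysics.QuantumFieldTheory.Balaban1983to89.B10Eq59Localization
  (vacuumWholeRaw_shape_exp_neg_R)

variable {T : TowerRun} {k : ℕ} {S : LocDomainSys} (G : CubeSystem S) {Δ : ℕ} {c₀ κ C : ℝ}

/-- **p. 270 L30–34 / p. 262 L14–29 as ONE two-sided inequality for the U-dependent perturbative sum**: at step k, with
the big blocks of T₁^{(k)} as LQB cube carriers (`G : CubeSystem S`, wall-degree ≤ Δ, volume leaf c₀), activities
`a h X U` of the localization domains X after the random-walk expansion («We get a sum of terms, each having a
localization domain X»: `hrep`, the graph representation of the printed cumulant sum `Σ_{n≤n̄} cum n/n!`), the decay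
**(25)** «|𝒫′(X, U)| ≤ O(g)e^{−κ𝓛(X)}» for all of them (`h25`, `κ ≥ κ₀(c₀,Δ) + 1`: «κ can be arbitrarily large if M₁ is
sufficiently large»), the retained sum **(59)** «over localizations X ⊂ Ω_{k+1} … contained in cubes of the size
R(g_k)M₁» AS THE DEFINITION of `P.PprU` (`hPprU`, threshold reading `𝓛(X) < R` of LQB, DIVERGENCE F5), the blocks of
`Z_k = Ω_{k+1}ᶜ` counted by `|Z_k|` (`hZ`), and the large-domain factor absorbed in the remainder unit (`hlarge`:
`(C·g_k·K₀·#blocks)·e^{−R} ≤ C₁·rem`, p. 262 «the factor exp(−R), which is smaller than arbitrary power of ε»):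
`|Σ_{n≤n̄} cum n/n! − PprU| ≤ (C·K₀(c₀,Δ))·g_k·|Z_k| + C₁·rem`.  LQB's `B10Eq59Localization.vacuumWholeRaw_shape_exp_neg_R`
by name (there for the vacuum terms; the inequality is the same for U-dependent activities).
[cite: Balaban1985UV3, (59) p.270 + (23)–(25) p.262] -/
theorem loc59_abs_of_bound25 (P : StepPieces T k) (hΔ : G.DegreeLE Δ) (hV : G.VolumeLeaf c₀)
    (hκ : kappa₀ c₀ Δ + 1 ≤ κ) (cum : T.Hist (k + 1) → T.Cfg (k + 1) → ℕ → ℝ) {nbar : ℕ}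
    (a : T.Hist (k + 1) → S.Dom → T.Cfg (k + 1) → ℝ) (Ωb : T.Hist (k + 1) → Finset G.Cube) {R C₁ : ℝ}
    (hR : 0 ≤ R) (hCg : 0 ≤ C * T.g k)
    (h25 : ∀ h : T.Hist (k + 1), B10.Bound25Printed ⟨S.Dom, T.Cfg (k + 1), S.dj, a h⟩ (T.g k) κ C)
    (hrep : ∀ (h : T.Hist (k + 1)) (U : T.Cfg (k + 1)),
      ∑ n ∈ Finset.Icc 1 nbar, cum h U n / (n ! : ℝ) = ∑ X : S.Dom, a h X U)
    (hPprU : ∀ (h : T.Hist (k + 1)) (U : T.Cfg (k + 1)), P.PprU h U =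
      ∑ X ∈ (Finset.univ.filter (fun X : S.Dom => G.cubes X ⊆ Ωb h)).filter (fun X => S.dj X < R), a h X U)
    (hZ : ∀ h : T.Hist (k + 1), (((Finset.univ : Finset G.Cube) \ Ωb h).card : ℝ) ≤ P.Zvol h)
    (hlarge : (C * T.g k * K₀ c₀ Δ * Fintype.card G.Cube) * Real.exp (-R) ≤ C₁ * P.rem)
    (h : T.Hist (k + 1)) (U : T.Cfg (k + 1)) :
    |∑ n ∈ Finset.Icc 1 nbar, cum h U n / (n ! : ℝ) - P.PprU h U|
      ≤ (C * K₀ c₀ Δ) * T.g k * P.Zvol h + C₁ * P.rem := by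
  rw [hrep h U, hPprU h U]
  exact (vacuumWholeRaw_shape_exp_neg_R G hΔ hV hκ (a h) hCg (h25 h) U (Ωb h) hR (hZ h)).trans (by linarith)

/-- **The upper localisation** (hypothesis `hloc` of `cumulant58_of_eq324`) from the graph representation + (25):
`Σ_{n≤n̄} cum n/n! ≤ PprU + (C·K₀(c₀,Δ))·g_k·|Z_k| + C₁·rem` at every history.
[cite: Balaban1985UV3, (59) p.270 + (24)–(25) p.262] -/
theorem loc59_upper_of_bound25 (P : StepPieces T k) (hΔ : G.DegreeLE Δ) (hV : G.VolumeLeaf c₀)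
    (hκ : kappa₀ c₀ Δ + 1 ≤ κ) (cum : T.Hist (k + 1) → T.Cfg (k + 1) → ℕ → ℝ) {nbar : ℕ}
    (a : T.Hist (k + 1) → S.Dom → T.Cfg (k + 1) → ℝ) (Ωb : T.Hist (k + 1) → Finset G.Cube) {R C₁ : ℝ}
    (hR : 0 ≤ R) (hCg : 0 ≤ C * T.g k)
    (h25 : ∀ h : T.Hist (k + 1), B10.Bound25Printed ⟨S.Dom, T.Cfg (k + 1), S.dj, a h⟩ (T.g k) κ C)
    (hrep : ∀ (h : T.Hist (k + 1)) (U : T.Cfg (k + 1)),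
      ∑ n ∈ Finset.Icc 1 nbar, cum h U n / (n ! : ℝ) = ∑ X : S.Dom, a h X U)
    (hPprU : ∀ (h : T.Hist (k + 1)) (U : T.Cfg (k + 1)), P.PprU h U =
      ∑ X ∈ (Finset.univ.filter (fun X : S.Dom => G.cubes X ⊆ Ωb h)).filter (fun X => S.dj X < R), a h X U)
    (hZ : ∀ h : T.Hist (k + 1), (((Finset.univ : Finset G.Cube) \ Ωb h).card : ℝ) ≤ P.Zvol h)
    (hlarge : (C * T.g k * K₀ c₀ Δ * Fintype.card G.Cube) * Real.exp (-R) ≤ C₁ * P.rem)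
    (h : T.Hist (k + 1)) (U : T.Cfg (k + 1)) :
    ∑ n ∈ Finset.Icc 1 nbar, cum h U n / (n ! : ℝ) ≤ P.PprU h U + (C * K₀ c₀ Δ) * T.g k * P.Zvol h + C₁ * P.rem := by
  have h1 := (abs_le.1 (loc59_abs_of_bound25 G P hΔ hV hκ cum a Ωb hR hCg h25 hrep hPprU hZ hlarge h U)).2
  linarith

/-- **The lower localisation at the trivial history** (hypothesis `hloc` of `cumulantLower_of_eq324`): there
`|Z_k| = 0` (`P.Zvol_triv`: Ω_{k+1} = T_η, p. 272 «all simplifications coming from the fact that Ω_{k+1} = T_η»), so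
`PprU − C₁·rem ≤ Σ_{n≤n̄} cum n/n!`. [cite: Balaban1985UV3, p.272 + (59) p.270] -/
theorem loc59_lower_of_bound25 (P : StepPieces T k) (hΔ : G.DegreeLE Δ) (hV : G.VolumeLeaf c₀)
    (hκ : kappa₀ c₀ Δ + 1 ≤ κ) (cum : T.Hist (k + 1) → T.Cfg (k + 1) → ℕ → ℝ) {nbar : ℕ}
    (a : T.Hist (k + 1) → S.Dom → T.Cfg (k + 1) → ℝ) (Ωb : T.Hist (k + 1) → Finset G.Cube) {R C₁ : ℝ}
    (hR : 0 ≤ R) (hCg : 0 ≤ C * T.g k)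
    (h25 : ∀ h : T.Hist (k + 1), B10.Bound25Printed ⟨S.Dom, T.Cfg (k + 1), S.dj, a h⟩ (T.g k) κ C)
    (hrep : ∀ (h : T.Hist (k + 1)) (U : T.Cfg (k + 1)),
      ∑ n ∈ Finset.Icc 1 nbar, cum h U n / (n ! : ℝ) = ∑ X : S.Dom, a h X U)
    (hPprU : ∀ (h : T.Hist (k + 1)) (U : T.Cfg (k + 1)), P.PprU h U =
      ∑ X ∈ (Finset.univ.filter (fun X : S.Dom => G.cubes X ⊆ Ωb h)).filter (fun X => S.dj X < R), a h X U)
    (hZ : ∀ h : T.Hist (k + 1), (((Finset.univ : Finset G.Cube) \ Ωb h).card : ℝ) ≤ P.Zvol h)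
    (hlarge : (C * T.g k * K₀ c₀ Δ * Fintype.card G.Cube) * Real.exp (-R) ≤ C₁ * P.rem)
    (U : T.Cfg (k + 1)) :
    P.PprU (T.triv (k + 1)) U - C₁ * P.rem ≤ ∑ n ∈ Finset.Icc 1 nbar, cum (T.triv (k + 1)) U n / (n ! : ℝ) := by
  have h1 := (abs_le.1 (loc59_abs_of_bound25 G P hΔ hV hκ cum a Ωb hR hCg h25 hrep hPprU hZ hlarge
    (T.triv (k + 1)) U)).1
  rw [P.Zvol_triv, mul_zero, zero_add] at h1
  linarith

/-! ## §2 The two leaves from (3.24) + (58)-reading + graph representation + (25), constants displayed -/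

/-- **`Cumulant58` for ANY carrier from the lane's inputs, constants displayed**: (58)-reading (`C₀`), (3.24) (`Eq324`,
error `C₂·s^κ·vol ≤ C₂·rem`), graph representation + (25) over the cube carriers (`Cz = C·K₀(c₀,Δ)`, large-domain
constant `C₁`) ⇒ `Cumulant58 P (C·K₀(c₀,Δ)) (C₀ + C₁ + C₂)`.  The bookkeeping of `Cumulant324.cumulant58_of_eq324`
composed with `loc59_upper_of_bound25`; nothing of the series is used. [cite: Balaban1985UV3, (24)–(25) p.262 + (58)–(59) p.270] -/
theorem cumulant58_of_eq324_bound25 (P : StepPieces T k) (hΔ : G.DegreeLE Δ) (hV : G.VolumeLeaf c₀)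
    (hκ : kappa₀ c₀ Δ + 1 ≤ κ)
    (lhs : T.Hist (k + 1) → T.Cfg (k + 1) → ℝ) (cum : T.Hist (k + 1) → T.Cfg (k + 1) → ℕ → ℝ) {nbar : ℕ}
    (a : T.Hist (k + 1) → S.Dom → T.Cfg (k + 1) → ℝ) (Ωb : T.Hist (k + 1) → Finset G.Cube)
    {C₀ C₁ C₂ R s κ' vol : ℝ}
    (hFl : ∀ (h : T.Hist (k + 1)) (U : T.Cfg (k + 1)), P.logFl h U ≤ Real.log (lhs h U) + C₀ * P.rem)
    (h324 : ∀ (h : T.Hist (k + 1)) (U : T.Cfg (k + 1)), Eq324 (lhs h U) (cum h U) nbar C₂ s κ' vol)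
    (hC₂ : 0 ≤ C₂) (hrem : s ^ κ' * vol ≤ P.rem)
    (hR : 0 ≤ R) (hCg : 0 ≤ C * T.g k)
    (h25 : ∀ h : T.Hist (k + 1), B10.Bound25Printed ⟨S.Dom, T.Cfg (k + 1), S.dj, a h⟩ (T.g k) κ C)
    (hrep : ∀ (h : T.Hist (k + 1)) (U : T.Cfg (k + 1)),
      ∑ n ∈ Finset.Icc 1 nbar, cum h U n / (n ! : ℝ) = ∑ X : S.Dom, a h X U)
    (hPprU : ∀ (h : T.Hist (k + 1)) (U : T.Cfg (k + 1)), P.PprU h U =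
      ∑ X ∈ (Finset.univ.filter (fun X : S.Dom => G.cubes X ⊆ Ωb h)).filter (fun X => S.dj X < R), a h X U)
    (hZ : ∀ h : T.Hist (k + 1), (((Finset.univ : Finset G.Cube) \ Ωb h).card : ℝ) ≤ P.Zvol h)
    (hlarge : (C * T.g k * K₀ c₀ Δ * Fintype.card G.Cube) * Real.exp (-R) ≤ C₁ * P.rem) :
    Cumulant58 P (C * K₀ c₀ Δ) (C₀ + C₁ + C₂) := by
  intro h U
  have h1 := hFl h U
  have h2 := (abs_le.1 (B1Eq324CumulantTaylor.abs_log_sub_le_of_eq324 (h324 h U))).2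
  have h3 := loc59_upper_of_bound25 G P hΔ hV hκ cum a Ωb hR hCg h25 hrep hPprU hZ hlarge h U
  have h4 : C₂ * s ^ κ' * vol ≤ C₂ * P.rem := by
    rw [mul_assoc]; exact mul_le_mul_of_nonneg_left hrem hC₂
  linarith

/-- **`CumulantLower` for ANY carrier from the lane's inputs**: the (58)-reading from below and (3.24) at the trivial
history, graph representation + (25) ⇒ `CumulantLower P (C₀ + C₁ + C₂)`.  The bookkeeping of
`Cumulant324.cumulantLower_of_eq324` composed with `loc59_lower_of_bound25`. [cite: Balaban1985UV3, (37) p.265 + p.272 + (59) p.270] -/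
theorem cumulantLower_of_eq324_bound25 (P : StepPieces T k) (hΔ : G.DegreeLE Δ) (hV : G.VolumeLeaf c₀)
    (hκ : kappa₀ c₀ Δ + 1 ≤ κ)
    (lhs : T.Hist (k + 1) → T.Cfg (k + 1) → ℝ) (cum : T.Hist (k + 1) → T.Cfg (k + 1) → ℕ → ℝ) {nbar : ℕ}
    (a : T.Hist (k + 1) → S.Dom → T.Cfg (k + 1) → ℝ) (Ωb : T.Hist (k + 1) → Finset G.Cube)
    {C₀ C₁ C₂ R s κ' vol : ℝ}
    (hFl : ∀ U : T.Cfg (k + 1),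
      Real.log (lhs (T.triv (k + 1)) U) - C₀ * P.rem ≤ P.logFl (T.triv (k + 1)) U)
    (h324 : ∀ U : T.Cfg (k + 1), Eq324 (lhs (T.triv (k + 1)) U) (cum (T.triv (k + 1)) U) nbar C₂ s κ' vol)
    (hC₂ : 0 ≤ C₂) (hrem : s ^ κ' * vol ≤ P.rem)
    (hR : 0 ≤ R) (hCg : 0 ≤ C * T.g k)
    (h25 : ∀ h : T.Hist (k + 1), B10.Bound25Printed ⟨S.Dom, T.Cfg (k + 1), S.dj, a h⟩ (T.g k) κ C)
    (hrep : ∀ (h : T.Hist (k + 1)) (U : T.Cfg (k + 1)),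
      ∑ n ∈ Finset.Icc 1 nbar, cum h U n / (n ! : ℝ) = ∑ X : S.Dom, a h X U)
    (hPprU : ∀ (h : T.Hist (k + 1)) (U : T.Cfg (k + 1)), P.PprU h U =
      ∑ X ∈ (Finset.univ.filter (fun X : S.Dom => G.cubes X ⊆ Ωb h)).filter (fun X => S.dj X < R), a h X U)
    (hZ : ∀ h : T.Hist (k + 1), (((Finset.univ : Finset G.Cube) \ Ωb h).card : ℝ) ≤ P.Zvol h)
    (hlarge : (C * T.g k * K₀ c₀ Δ * Fintype.card G.Cube) * Real.exp (-R) ≤ C₁ * P.rem) :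
    CumulantLower P (C₀ + C₁ + C₂) := by
  intro U
  have h1 := hFl U
  have h2 := (abs_le.1 (B1Eq324CumulantTaylor.abs_log_sub_le_of_eq324 (h324 U))).1
  have h3 := loc59_lower_of_bound25 G P hΔ hV hκ cum a Ωb hR hCg h25 hrep hPprU hZ hlarge U
  have h4 : C₂ * s ^ κ' * vol ≤ C₂ * P.rem := by
    rw [mul_assoc]; exact mul_le_mul_of_nonneg_left hrem hC₂
  linarith

end Loc59

/-! ## §3 On LQB's concrete 3-torus block system: the carrier leaves discharged -/

section Torus

open Literature.MathematicalPhysics.QuantumFieldTheory.Balaban1983to89.B12TreeDecay (kappa₀ K₀)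
open Literature.MathematicalPhysics.QuantumFieldTheory.Balaban1983to89.TreeLengthTorus
  (tsys tcubeSys tdegreeLE tvolumeLeaf card_tcube)

variable {T : TowerRun} {k : ℕ} {C : ℝ} {κ : ℝ}

/-- **`Cumulant58` on the 3-torus block carrier**: the scale-k big blocks of T₁^{(k)} as LQB's periodic cube system
`tcubeSys 3 N` (N blocks per direction; wall-degree ≤ 6 and the volume leaf with c₀ = 32 are LQB THEOREMS
`tdegreeLE`/`tvolumeLeaf`, #blocks = N³ is `card_tcube`); the remaining hypotheses are the 𝔇-data ones of
`cumulant58_of_eq324_bound25` ((58)-reading, (3.24), (25) with `κ ≥ κ₀(32,6) + 1`, graph representation, the (59)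
definition of `PprU`, `#(blocks ∖ Ω(h)) ≤ |Z_k|`, `(C·g_k·K₀(32,6)·N³)·e^{−R} ≤ C₁·rem`).  Constants `Cz = C·K₀(32,6)`,
`C′ = C₀ + C₁ + C₂`. [cite: Balaban1985UV3, (24)–(25) p.262 + (58)–(59) p.270] -/
theorem cumulant58_torus (N : ℕ) [NeZero N] (P : StepPieces T k) (hκ : kappa₀ (4 * 2 ^ 3) (2 * 3) + 1 ≤ κ)
    (lhs : T.Hist (k + 1) → T.Cfg (k + 1) → ℝ) (cum : T.Hist (k + 1) → T.Cfg (k + 1) → ℕ → ℝ) {nbar : ℕ}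
    (a : T.Hist (k + 1) → (tsys 3 N).Dom → T.Cfg (k + 1) → ℝ)
    (Ωb : T.Hist (k + 1) → Finset (tcubeSys 3 N).Cube) {C₀ C₁ C₂ R s κ' vol : ℝ}
    (hFl : ∀ (h : T.Hist (k + 1)) (U : T.Cfg (k + 1)), P.logFl h U ≤ Real.log (lhs h U) + C₀ * P.rem)
    (h324 : ∀ (h : T.Hist (k + 1)) (U : T.Cfg (k + 1)), Eq324 (lhs h U) (cum h U) nbar C₂ s κ' vol)
    (hC₂ : 0 ≤ C₂) (hrem : s ^ κ' * vol ≤ P.rem) (hR : 0 ≤ R) (hCg : 0 ≤ C * T.g k)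
    (h25 : ∀ h : T.Hist (k + 1),
      B10.Bound25Printed ⟨(tsys 3 N).Dom, T.Cfg (k + 1), (tsys 3 N).dj, a h⟩ (T.g k) κ C)
    (hrep : ∀ (h : T.Hist (k + 1)) (U : T.Cfg (k + 1)),
      ∑ n ∈ Finset.Icc 1 nbar, cum h U n / (n ! : ℝ) = ∑ X : (tsys 3 N).Dom, a h X U)
    (hPprU : ∀ (h : T.Hist (k + 1)) (U : T.Cfg (k + 1)), P.PprU h U =
      ∑ X ∈ (Finset.univ.filter (fun X : (tsys 3 N).Dom => (tcubeSys 3 N).cubes X ⊆ Ωb h)).filter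
        (fun X => (tsys 3 N).dj X < R), a h X U)
    (hZ : ∀ h : T.Hist (k + 1), (((Finset.univ : Finset (tcubeSys 3 N).Cube) \ Ωb h).card : ℝ) ≤ P.Zvol h)
    (hlarge : (C * T.g k * K₀ (4 * 2 ^ 3) (2 * 3) * (N : ℝ) ^ 3) * Real.exp (-R) ≤ C₁ * P.rem) :
    Cumulant58 P (C * K₀ (4 * 2 ^ 3) (2 * 3)) (C₀ + C₁ + C₂) := by
  have hcard : (Fintype.card (tcubeSys 3 N).Cube : ℝ) = (N : ℝ) ^ 3 := by
    rw [card_tcube]; push_cast; rfl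
  refine cumulant58_of_eq324_bound25 (tcubeSys 3 N) P (tdegreeLE 3 N) (tvolumeLeaf 3 N) hκ lhs cum a Ωb
    hFl h324 hC₂ hrem hR hCg h25 hrep hPprU hZ ?_
  rwa [hcard]

/-- **`CumulantLower` on the 3-torus block carrier** — as `cumulant58_torus`, lower direction at the trivial history.
[cite: Balaban1985UV3, (37) p.265 + p.272 + (59) p.270] -/
theorem cumulantLower_torus (N : ℕ) [NeZero N] (P : StepPieces T k) (hκ : kappa₀ (4 * 2 ^ 3) (2 * 3) + 1 ≤ κ)
    (lhs : T.Hist (k + 1) → T.Cfg (k + 1) → ℝ) (cum : T.Hist (k + 1) → T.Cfg (k + 1) → ℕ → ℝ) {nbar : ℕ}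
    (a : T.Hist (k + 1) → (tsys 3 N).Dom → T.Cfg (k + 1) → ℝ)
    (Ωb : T.Hist (k + 1) → Finset (tcubeSys 3 N).Cube) {C₀ C₁ C₂ R s κ' vol : ℝ}
    (hFl : ∀ U : T.Cfg (k + 1),
      Real.log (lhs (T.triv (k + 1)) U) - C₀ * P.rem ≤ P.logFl (T.triv (k + 1)) U)
    (h324 : ∀ U : T.Cfg (k + 1), Eq324 (lhs (T.triv (k + 1)) U) (cum (T.triv (k + 1)) U) nbar C₂ s κ' vol)
    (hC₂ : 0 ≤ C₂) (hrem : s ^ κ' * vol ≤ P.rem) (hR : 0 ≤ R) (hCg : 0 ≤ C * T.g k)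
    (h25 : ∀ h : T.Hist (k + 1),
      B10.Bound25Printed ⟨(tsys 3 N).Dom, T.Cfg (k + 1), (tsys 3 N).dj, a h⟩ (T.g k) κ C)
    (hrep : ∀ (h : T.Hist (k + 1)) (U : T.Cfg (k + 1)),
      ∑ n ∈ Finset.Icc 1 nbar, cum h U n / (n ! : ℝ) = ∑ X : (tsys 3 N).Dom, a h X U)
    (hPprU : ∀ (h : T.Hist (k + 1)) (U : T.Cfg (k + 1)), P.PprU h U =
      ∑ X ∈ (Finset.univ.filter (fun X : (tsys 3 N).Dom => (tcubeSys 3 N).cubes X ⊆ Ωb h)).filter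
        (fun X => (tsys 3 N).dj X < R), a h X U)
    (hZ : ∀ h : T.Hist (k + 1), (((Finset.univ : Finset (tcubeSys 3 N).Cube) \ Ωb h).card : ℝ) ≤ P.Zvol h)
    (hlarge : (C * T.g k * K₀ (4 * 2 ^ 3) (2 * 3) * (N : ℝ) ^ 3) * Real.exp (-R) ≤ C₁ * P.rem) :
    CumulantLower P (C₀ + C₁ + C₂) := by
  have hcard : (Fintype.card (tcubeSys 3 N).Cube : ℝ) = (N : ℝ) ^ 3 := by
    rw [card_tcube]; push_cast; rfl
  refine cumulantLower_of_eq324_bound25 (tcubeSys 3 N) P (tdegreeLE 3 N) (tvolumeLeaf 3 N) hκ lhs cum a Ωb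
    hFl h324 hC₂ hrem hR hCg h25 hrep hPprU hZ ?_
  rwa [hcard]

end Torus

end Summit.QuantumFields.Balaban3D.Proofs
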